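import Summits.AnomalousDissipation.AnomalousDissipation.Theorems.ScalarZerothLawKinematicPeriod
import HarnessLib

/-!
# Scalar zeroth law over a prescribed carrier — dissipation equals injection up to boundary terms

Cell `ad-ideate`, planner ad-ideate-p1 ROUND-10 §B3, Step 2, for an `L²`-continuous global weak
solution `w` of `∂ₜθ + b·∇θ = κ ∑ᵢ aᵢ ∂ᵢ∂ᵢθ + S` with bounded drift, steady `L²` source, `κ > 0`,
`0 < aᵢ ≤ 1` (setting of `ScalarZerothLawKinematicPeriod.lean`):

* `aemeasurable_eScalarGradNormSq`, `integrableOn_toReal_eScalarGradNormSq` — the isotropic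
  spectral dissipation `t ↦ ‖∇w(t)‖²_{L²}` (`Torus.eScalarGradNormSq`, `.toReal`) is integrable on
  every `(0,T)` (it is dominated by `m⁻¹ ‖∇w‖²_a`, `m = min aᵢ`, which the energy layer integrates);
* `integral_source_mul_sub_le_integral_dissipation` — for every `T ≥ 0`,
  `∫₀ᵀ ∫ S w - ‖w(T)‖²/2 ≤ ∫₀ᵀ κ ‖∇w‖²_{L²}` (the energy EQUALITY between `0` and `T`,
  `energy_eq_sub_of_isL2ContinuousOn`, and `‖∇w‖²_a ≤ ‖∇w‖²` for `aᵢ ≤ 1`);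
* `integral_dissipation_le` — `∫₀ᵀ κ ‖∇w‖² ≤ m⁻¹ (‖θ₀‖²/2 + ∫₀ᵀ ∫ S w)`;
* `timeMean_congr_ae` tools — the running means of `‖θ(t)‖²` and of `κ‖∇θ(t)‖²` agree for two
  fields equal a.e. in space for a.e. time (so the statements transfer from `w` to any weak solution
  it represents).

Supports stmt-AnomalousDissipation-0448 (prescribed-carrier rung; no statement about Navier–Stokes).
-/

noncomputable section

-- `Summit.<Summit>.<Problem>` is the tree's mandated summit-side namespace (CONVENTIONS §2); for this
-- single-conjunct summit the two coincide, so the duplicate is deliberate.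
set_option linter.dupNamespace false

namespace Summit.AnomalousDissipation.AnomalousDissipation.Theorems.ScalarZerothLawKinematic

open MeasureTheory Set Filter Topology Function UnitAddTorus
open scoped NNReal ENNReal InnerProductSpace
open Literature.Analysis Literature.Analysis.FluidPDE Literature.Analysis.FunctionSpaces
open Literature.Analysis.FluidPDE.Torus Literature.Analysis.FunctionSpaces.Torus

section Dissipation

variable {d : Type*} [Fintype d] [DecidableEq d]
  {a : d → ℝ} {κ A T : ℝ} {b : ℝ → UnitAddTorus d → EuclideanSpace ℝ d}
  {S θ₀ : UnitAddTorus d → ℝ} {w : ℝ → UnitAddTorus d → ℝ} {s : ℝ → UnitAddTorus d → ℝ}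

/-! ## The isotropic dissipation of a weak solution is integrable in time -/

/-- The isotropic spectral dissipation `t ↦ ‖∇θ(t)‖²_{L²}` of a weak solution is a.e.-measurable on
`(0,T)` (a countable sum of squared moduli of Fourier coefficients, each measurable in time by
Fubini). -/
theorem aemeasurable_eScalarGradNormSq {θ : ℝ → UnitAddTorus d → ℝ}
    (h : IsWeakScalarTransportDiagForcedOn T a κ b s θ₀ θ) :
    AEMeasurable (fun t => Torus.eScalarGradNormSq (θ t)) (volume.restrict (Ioo 0 T)) := by
  -- adapted from `IsWeakScalarTransportOn.aemeasurable_eScalarGradNormSq` (PassiveScalarSpectralBounds.lean)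
  have hcoef : ∀ k : d → ℤ, AEStronglyMeasurable (fun t => mFourierCoeff (fun x => (θ t x : ℂ)) k)
      (volume.restrict (Ioo 0 T)) := by
    intro k
    have e : (fun t => mFourierCoeff (fun x => (θ t x : ℂ)) k) = fun t => ∫ x, mFourier (-k) x • (θ t x : ℂ) := by
      funext t
      exact FunctionSpaces.Torus.mFourierCoeff_eq_integral_volume _ k
    rw [e]
    have hm : AEStronglyMeasurable (uncurry fun t x => mFourier (-k) x • (θ t x : ℂ))
        (((volume : Measure ℝ).restrict (Ioo 0 T)).prod volume) :=
      ((mFourier (-k)).continuous.comp continuous_snd).aestronglyMeasurable.smul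
        (Complex.continuous_ofReal.comp_aestronglyMeasurable h.aestronglyMeasurable_uncurry)
    exact hm.integral_prod_right'
  have e : (fun t => Torus.eScalarGradNormSq (θ t)) = fun t => ENNReal.ofReal (4 * Real.pi ^ 2) *
      ∑' k : d → ℤ, ENNReal.ofReal (FunctionSpaces.Torus.freqNormSq k) *
        ‖mFourierCoeff (fun x => (θ t x : ℂ)) k‖ₑ ^ 2 := by
    funext t
    exact Torus.eScalarGradNormSq_eq_tsum (θ t)
  rw [e]
  refine AEMeasurable.const_mul (AEMeasurable.tsum fun k => ?_) _
  exact (((hcoef k).enorm.pow_const 2).const_mul _)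

/-- **The isotropic dissipation is dominated by the `A`-dissipation**: for `0 < m ≤ aᵢ`, a.e. in
`t ∈ (0,T)`, `‖∇θ(t)‖² < ∞` and `(‖∇θ(t)‖²).toReal ≤ m⁻¹ (‖∇θ(t)‖²_a).toReal`, whenever the
`A`-dissipation is integrable (the energy layer: `κ > 0`, `θ₀ ∈ L²`, bounded drift, `L¹_t L²_x`
source). -/
theorem ae_toReal_eScalarGradNormSq_le {θ : ℝ → UnitAddTorus d → ℝ}
    (h : IsWeakScalarTransportDiagForcedOn T a κ b s θ₀ θ) (hκ : 0 < κ) (ha : ∀ i, 0 < a i)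
    (hθ₀ : MemLp θ₀ 2 volume) (hu : MemLp (stLift b) ⊤ (volume.restrict (Ioo 0 T ×ˢ univ)))
    (hs : ∫⁻ t in Ioo 0 T, (∫⁻ x, ‖s t x‖ₑ ^ 2) ^ (1 / 2 : ℝ) < ⊤) {m : ℝ} (hm : 0 < m)
    (hma : ∀ i, m ≤ a i) :
    ∀ᵐ t ∂(volume.restrict (Ioo 0 T)), Torus.eScalarGradNormSq (θ t) < ⊤ ∧
      (Torus.eScalarGradNormSq (θ t)).toReal ≤ m⁻¹ * (Torus.eScalarGradNormSqDiag a (θ t)).toReal := by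
  have hfin := h.lintegral_eScalarGradNormSqDiag_lt_top hκ ha hθ₀ hu hs
  have hmeas := h.aemeasurable_eScalarGradNormSqDiag fun i => (ha i).le
  filter_upwards [ae_lt_top' hmeas hfin.ne] with t ht
  have hcmp := Torus.mul_eScalarGradNormSq_le_diag hm.le hma (θ t)
  have hm' : ENNReal.ofReal m ≠ 0 := by simpa using hm
  have hlt : Torus.eScalarGradNormSq (θ t) < ⊤ := by
    have : ENNReal.ofReal m * Torus.eScalarGradNormSq (θ t) < ⊤ := lt_of_le_of_lt hcmp ht
    exact (ENNReal.mul_lt_top_iff.1 this).elim (fun h' => h'.2) fun h' => by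
      rcases h' with h' | h'
      · exact absurd h' hm'
      · rw [h']; exact ENNReal.zero_lt_top
  refine ⟨hlt, ?_⟩
  have h1 := ENNReal.toReal_mono ht.ne hcmp
  rw [ENNReal.toReal_mul, ENNReal.toReal_ofReal hm.le] at h1
  rw [le_inv_mul_iff₀ hm]
  linarith

/-- **The isotropic dissipation of a weak solution with positive diagonal coefficients is
integrable on `(0,T)`** (energy layer + domination). -/
theorem integrableOn_toReal_eScalarGradNormSq {θ : ℝ → UnitAddTorus d → ℝ}
    (h : IsWeakScalarTransportDiagForcedOn T a κ b s θ₀ θ) (hκ : 0 < κ) (ha : ∀ i, 0 < a i)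
    (hθ₀ : MemLp θ₀ 2 volume) (hu : MemLp (stLift b) ⊤ (volume.restrict (Ioo 0 T ×ˢ univ)))
    (hs : ∫⁻ t in Ioo 0 T, (∫⁻ x, ‖s t x‖ₑ ^ 2) ^ (1 / 2 : ℝ) < ⊤) {m : ℝ} (hm : 0 < m)
    (hma : ∀ i, m ≤ a i) :
    IntegrableOn (fun t => (Torus.eScalarGradNormSq (θ t)).toReal) (Ioo 0 T) volume := by
  obtain ⟨hI, -⟩ := h.integrableOn_toReal_eScalarGradNormSqDiag hκ ha hθ₀ hu hs
  refine Integrable.mono' (hI.const_mul m⁻¹) (aemeasurable_eScalarGradNormSq h).ennreal_toReal.aestronglyMeasurable ?_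
  filter_upwards [ae_toReal_eScalarGradNormSq_le h hκ ha hθ₀ hu hs hm hma] with t ht
  rw [Real.norm_eq_abs, abs_of_nonneg ENNReal.toReal_nonneg]
  exact ht.2

/-! ## Dissipation versus injection for an `L²`-continuous global weak solution -/

/-- **Step 2, lower bound: the dissipation is at least the injection minus the final energy.** For
an `L²`-continuous global weak solution with bounded drift, steady `L²` source, `κ > 0`,
`0 < aᵢ ≤ 1`, and every `T ≥ 0`:
`∫_{(0,T)} ∫ S w - ‖w(T)‖²_{L²}/2 ≤ ∫₀ᵀ κ ‖∇w(t)‖²_{L²} dt`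
(energy equality `‖w(T)‖² + 2κ∫₀ᵀ‖∇w‖²_a = ‖w(0)‖² + 2∫₀ᵀ∫ S w` and `‖∇w‖²_a ≤ ‖∇w‖²`). -/
theorem integral_source_mul_sub_le_integral_dissipation
    (hw : IsWeakScalarTransportDiagForced a κ b (fun _ => S) θ₀ w) (hwc : IsL2ContinuousOn (Ici 0) w)
    (hκ : 0 < κ) (ha : ∀ i, 0 < a i) (ha1 : ∀ i, a i ≤ 1) (hθ₀ : MemLp θ₀ 2 volume)
    (hbA : ∀ (t : ℝ) (x : UnitAddTorus d), ‖b t x‖ ≤ A) (hS2 : MemLp S 2 volume) (hT : 0 ≤ T) :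
    (∫ τ in Ioo 0 T, ∫ x, S x * w τ x) - (∫ x, w T x ^ 2) / 2 ≤
      ∫ τ in (0 : ℝ)..T, κ * (Torus.eScalarGradNormSq (w τ)).toReal := by
  have hu := fun T' (hT' : 0 < T') => memLp_top_drift hw hbA hT'
  have hs := fun T' (_ : 0 < T') => lintegral_steady_source_lt_top (S := S) hS2 T'
  have hE := hw.energy_eq_sub_of_isL2ContinuousOn hκ ha hθ₀ hu hs hwc le_rfl hT
  rcases hT.eq_or_lt with hT0 | hTpos
  · subst hT0
    have hnn' : 0 ≤ ∫ x, w 0 x ^ 2 := integral_nonneg fun x => sq_nonneg _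
    simp only [intervalIntegral.integral_same, Ioo_self, Measure.restrict_empty, integral_zero_measure]
    linarith
  -- horizon `T' = T + 1` for the finite-horizon lemmas
  have hT1 : 0 < T + 1 := by linarith
  have hsol := hw (T + 1) hT1
  obtain ⟨m, hm, hma⟩ : ∃ m : ℝ, 0 < m ∧ ∀ i, m ≤ a i := by
    classical
    rcases isEmpty_or_nonempty d with hd | hd
    · exact ⟨1, one_pos, fun i => (IsEmpty.false i).elim⟩
    · obtain ⟨i₀, -, hi₀⟩ := Finset.exists_min_image Finset.univ a Finset.univ_nonempty
      exact ⟨a i₀, ha i₀, fun i => hi₀ i (Finset.mem_univ _)⟩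
  obtain ⟨hIa, hIa_eq⟩ := hsol.integrableOn_toReal_eScalarGradNormSqDiag hκ ha hθ₀ (hu _ hT1) (hs _ hT1)
  have hI := integrableOn_toReal_eScalarGradNormSq hsol hκ ha hθ₀ (hu _ hT1) (hs _ hT1) hm hma
  have hsub : Ioo 0 T ⊆ Ioo 0 (T + 1) := Ioo_subset_Ioo_right (by linarith)
  -- `∫_{(0,T)} ‖∇w‖²_a ≤ ∫_{(0,T)} ‖∇w‖²`
  have hcmp : ∫ τ in Ioo 0 T, (Torus.eScalarGradNormSqDiag a (w τ)).toReal ≤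
      ∫ τ in Ioo 0 T, (Torus.eScalarGradNormSq (w τ)).toReal := by
    refine setIntegral_mono_ae_restrict (hIa.mono_set hsub) (hI.mono_set hsub) ?_
    refine ae_restrict_of_ae_restrict_of_subset hsub ?_
    filter_upwards [ae_toReal_eScalarGradNormSq_le hsol hκ ha hθ₀ (hu _ hT1) (hs _ hT1) hm hma] with τ hτ
    have hle := Torus.eScalarGradNormSqDiag_le_mul zero_le_one ha1 (w τ)
    rw [ENNReal.ofReal_one, one_mul] at hle
    exact ENNReal.toReal_mono hτ.1.ne hle
  have hD : (∫⁻ τ in Ioo 0 T, Torus.eScalarGradNormSqDiag a (w τ)).toReal =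
      ∫ τ in Ioo 0 T, (Torus.eScalarGradNormSqDiag a (w τ)).toReal := (hIa_eq T (by linarith)).symm
  -- the energy equality between `0` and `T`
  have h0 : ∫ x, w 0 x ^ 2 = ∫ x, θ₀ x ^ 2 := by
    have := (hw 1 one_pos).zero_ae_eq_of_isL2ContinuousOn one_pos hθ₀ (hwc.mono Icc_subset_Ici_self)
    exact integral_congr_ae (this.mono fun x hx => by simp only [hx])
  rw [intervalIntegral.integral_of_le hT, setIntegral_congr_set (Ioo_ae_eq_Ioc (μ := (volume : Measure ℝ))).symm,
    integral_const_mul]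
  rw [hD] at hE
  have hnn : 0 ≤ ∫ x, θ₀ x ^ 2 := integral_nonneg fun x => sq_nonneg _
  nlinarith [mul_le_mul_of_nonneg_left hcmp hκ.le]

/-- **Step 2, upper bound: the dissipation is at most `m⁻¹` times the initial energy plus the
injection**, `m = min aᵢ`: for every `T ≥ 0`,
`∫₀ᵀ κ ‖∇w‖²_{L²} ≤ m⁻¹ (‖θ₀‖²/2 + ∫_{(0,T)} ∫ S w)` (energy equality and
`m ‖∇w‖² ≤ ‖∇w‖²_a`). -/
theorem integral_dissipation_le (hw : IsWeakScalarTransportDiagForced a κ b (fun _ => S) θ₀ w)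
    (hwc : IsL2ContinuousOn (Ici 0) w) (hκ : 0 < κ) (ha : ∀ i, 0 < a i) (hθ₀ : MemLp θ₀ 2 volume)
    (hbA : ∀ (t : ℝ) (x : UnitAddTorus d), ‖b t x‖ ≤ A) (hS2 : MemLp S 2 volume) {m : ℝ} (hm : 0 < m)
    (hma : ∀ i, m ≤ a i) (hT : 0 ≤ T) :
    ∫ τ in (0 : ℝ)..T, κ * (Torus.eScalarGradNormSq (w τ)).toReal ≤
      m⁻¹ * ((∫ x, θ₀ x ^ 2) / 2 + ∫ τ in Ioo 0 T, ∫ x, S x * w τ x) := by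
  have hu := fun T' (hT' : 0 < T') => memLp_top_drift hw hbA hT'
  have hs := fun T' (_ : 0 < T') => lintegral_steady_source_lt_top (S := S) hS2 T'
  have hE := hw.energy_eq_sub_of_isL2ContinuousOn hκ ha hθ₀ hu hs hwc le_rfl hT
  have hT1 : 0 < T + 1 := by linarith
  have hsol := hw (T + 1) hT1
  obtain ⟨hIa, hIa_eq⟩ := hsol.integrableOn_toReal_eScalarGradNormSqDiag hκ ha hθ₀ (hu _ hT1) (hs _ hT1)
  have hI := integrableOn_toReal_eScalarGradNormSq hsol hκ ha hθ₀ (hu _ hT1) (hs _ hT1) hm hma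
  have hsub : Ioo 0 T ⊆ Ioo 0 (T + 1) := Ioo_subset_Ioo_right (by linarith)
  have hcmp : ∫ τ in Ioo 0 T, (Torus.eScalarGradNormSq (w τ)).toReal ≤
      ∫ τ in Ioo 0 T, m⁻¹ * (Torus.eScalarGradNormSqDiag a (w τ)).toReal := by
    refine setIntegral_mono_ae_restrict (hI.mono_set hsub) ((hIa.mono_set hsub).const_mul _) ?_
    refine ae_restrict_of_ae_restrict_of_subset hsub ?_
    filter_upwards [ae_toReal_eScalarGradNormSq_le hsol hκ ha hθ₀ (hu _ hT1) (hs _ hT1) hm hma] with τ hτ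
    exact hτ.2
  rw [integral_const_mul] at hcmp
  have hD : (∫⁻ τ in Ioo 0 T, Torus.eScalarGradNormSqDiag a (w τ)).toReal =
      ∫ τ in Ioo 0 T, (Torus.eScalarGradNormSqDiag a (w τ)).toReal := (hIa_eq T (by linarith)).symm
  have h0 : ∫ x, w 0 x ^ 2 = ∫ x, θ₀ x ^ 2 := by
    have := (hw 1 one_pos).zero_ae_eq_of_isL2ContinuousOn one_pos hθ₀ (hwc.mono Icc_subset_Ici_self)
    exact integral_congr_ae (this.mono fun x hx => by simp only [hx])
  rw [intervalIntegral.integral_of_le hT, setIntegral_congr_set (Ioo_ae_eq_Ioc (μ := (volume : Measure ℝ))).symm,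
    integral_const_mul]
  rw [hD, h0] at hE
  have hnn : 0 ≤ ∫ x, w T x ^ 2 := integral_nonneg fun x => sq_nonneg _
  have hκDa : κ * ∫ τ in Ioo 0 T, (Torus.eScalarGradNormSqDiag a (w τ)).toReal ≤
      (∫ x, θ₀ x ^ 2) / 2 + ∫ τ in Ioo 0 T, ∫ x, S x * w τ x := by linarith
  calc κ * ∫ τ in Ioo 0 T, (Torus.eScalarGradNormSq (w τ)).toReal
      ≤ κ * (m⁻¹ * ∫ τ in Ioo 0 T, (Torus.eScalarGradNormSqDiag a (w τ)).toReal) :=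
        mul_le_mul_of_nonneg_left hcmp hκ.le
    _ = m⁻¹ * (κ * ∫ τ in Ioo 0 T, (Torus.eScalarGradNormSqDiag a (w τ)).toReal) := by ring
    _ ≤ m⁻¹ * ((∫ x, θ₀ x ^ 2) / 2 + ∫ τ in Ioo 0 T, ∫ x, S x * w τ x) :=
        mul_le_mul_of_nonneg_left hκDa (inv_nonneg.2 hm.le)

/-! ## Transfer between a.e.-equal fields -/

omit [DecidableEq d] in
/-- `eScalarGradNormSq` only depends on the a.e. class of the slice. -/
theorem eScalarGradNormSq_congr_ae {f g : UnitAddTorus d → ℝ} (h : f =ᵐ[volume] g) :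
    Torus.eScalarGradNormSq f = Torus.eScalarGradNormSq g := by
  -- adapted from `Torus.eScalarGradNormSq_congr_ae_eq` (ReleaseLogBound.lean)
  rw [Torus.eScalarGradNormSq_eq_tsum, Torus.eScalarGradNormSq_eq_tsum]
  congr 1
  refine tsum_congr fun k => ?_
  have e : mFourierCoeff (fun x => (f x : ℂ)) k = mFourierCoeff (fun x => (g x : ℂ)) k := by
    rw [FunctionSpaces.Torus.mFourierCoeff_eq_integral_volume, FunctionSpaces.Torus.mFourierCoeff_eq_integral_volume]
    refine integral_congr_ae ?_
    filter_upwards [h] with x hx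
    rw [hx]
  rw [e]

omit [Fintype d] [DecidableEq d] in
/-- Running means of two time functions which agree for a.e. `t > 0` coincide at every `T ≥ 0`
(no integrability needed: the interval integral is the same Bochner integral on `(0,T]`). -/
theorem timeMean_congr_ae {f g : ℝ → ℝ} (h : ∀ᵐ t ∂(volume.restrict (Ioi (0 : ℝ))), f t = g t)
    {T : ℝ} (hT : 0 ≤ T) : timeMean f T = timeMean g T := by
  rw [timeMean, timeMean, intervalIntegral.integral_of_le hT, intervalIntegral.integral_of_le hT,
    integral_congr_ae (ae_restrict_of_ae_restrict_of_subset Ioc_subset_Ioi_self h)]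

end Dissipation

end Summit.AnomalousDissipation.AnomalousDissipation.Theorems.ScalarZerothLawKinematic

end
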